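import Mathlib
import Literature.AlgebraicGeometry.Tropical.TropicalLink
import Summits.ResolutionOfSingularities.ResolutionOfSingularities.Theorems.TropicalLinksSchonResolvesGrobnerFamilyFibre

/-!
# TropicalLinks / SchonResolves — the generic fibre of the Gröbner family

Route `ResolutionOfSingularities/TropicalLinks`, crux `SchonResolves` (stmt-ResolutionOfSingularities-17234),
line `zariski-toric-closure`, stub DIM-2 (dimension of initial degenerations).  For an ideal
`J ⊆ k[M]` of a Laurent polynomial ring (`M` any additive commutative group of exponents), the
extension `J^e = J.map k[inr]` of `J` to `k[ℤ × M] = k[t^±][M]` cuts out `𝔾_m × V(J)`, i.e. its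
coordinate ring is the Laurent polynomial ring over the coordinate ring of `V(J)`:

* `schonResolves_quotient_map_inr_algEquiv` (DIM-2) — `k[ℤ × M] ⧸ J^e ≃ₐ[k] (k[M] ⧸ J)[ℤ]`.

This is the tree's torus-factor splitting `quotientEquivOfIsHomogeneous` (file
`Literature/AlgebraicGeometry/Tropical/TropicalLink.lean`) for the `ℤ`-grading by the first exponent,
for which `J^e` is homogeneous (`isHomogeneous_map_mapDomainRingHom_inr`), transported along the
contraction `J^e ∩ k[M] = J` (`schonResolves_linkIdeal_inr_map_inr`).  Standard material
(Maclagan–Sturmfels, *Introduction to Tropical Geometry*, §2.4–2.6), here as self-contained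
commutative algebra over any commutative ring `k`; no new definitions.
-/

-- single-problem summit: the doubled namespace component `ResolutionOfSingularities` is forced
set_option linter.dupNamespace false

namespace Summit.ResolutionOfSingularities.ResolutionOfSingularities.Theorems

open AddMonoidAlgebra Literature.AlgebraicGeometry.Tropical

/-- **The generic fibre of the Gröbner family is `𝔾_m × V(J)`** (DIM-2): for an ideal `J ⊆ k[M]`
and its extension `J^e = J.map k[inr] ⊆ k[ℤ × M] = k[t^±][M]`, the coordinate ring of `V(J^e)` is
the Laurent polynomial ring over that of `V(J)`: `k[ℤ × M] ⧸ J^e ≃ₐ[k] (k[M] ⧸ J)[ℤ]`.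
(Torus-factor splitting `quotientEquivOfIsHomogeneous` of the `fst`-homogeneous ideal `J^e`, whose
link ideal `J^e ∩ k[M]` is `J`.) [folklore] -/
theorem schonResolves_quotient_map_inr_algEquiv : ∀ (k : Type) [CommRing k] (M : Type)
    [AddCommGroup M] (J : Ideal (AddMonoidAlgebra k M)),
    Nonempty ((AddMonoidAlgebra k (ℤ × M) ⧸
      J.map (AddMonoidAlgebra.mapDomainRingHom k (AddMonoidHom.inr ℤ M))) ≃ₐ[k]
        AddMonoidAlgebra (AddMonoidAlgebra k M ⧸ J) ℤ) := by
  intro k _ M _ J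
  classical
  -- generalise the target ideal `J` to the link ideal `J^e ∩ k[M]` (equal to `J`), so that the
  -- splitting isomorphism applies verbatim
  have key : ∀ I : Ideal (AddMonoidAlgebra k M),
      I = linkIdeal (AddMonoidHom.inr ℤ M) (J.map (mapDomainRingHom k (AddMonoidHom.inr ℤ M))) →
      Nonempty ((AddMonoidAlgebra k (ℤ × M) ⧸
        J.map (AddMonoidAlgebra.mapDomainRingHom k (AddMonoidHom.inr ℤ M))) ≃ₐ[k]
          AddMonoidAlgebra (AddMonoidAlgebra k M ⧸ I) ℤ) := by
    rintro I rfl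
    exact ⟨quotientEquivOfIsHomogeneous _ (isHomogeneous_map_mapDomainRingHom_inr J)⟩
  exact key J (schonResolves_linkIdeal_inr_map_inr (L' := ℤ) J).symm

end Summit.ResolutionOfSingularities.ResolutionOfSingularities.Theorems
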